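import Summits.QuantumFields.BalabanUV.Beta.PolyRegularAlgebra
import Literature.MathematicalPhysics.QuantumFieldTheory.Balaban1983to89.Beta.AliasingTailSlice

/-!
# Beta / TubeMaximumModulus — THE DISTINGUISHED-BOUNDARY MAXIMUM PRINCIPLE for periodic poly-holomorphic multipliers:
# the (Z2) binder `‖G‖ ≤ M on the polystrip` from a bound on the VERTEX TORI only (β sub-cell, BINDER-OWNERS row CAP-k,
# lineage `b2b-balaban-beta-an5`, gen 21; node BETA-an5-g21-FACE-MAXMOD, journal l.4988)

Every (S4) row of the cell (`CapRowsLattice.rowsOfCode16(E)`, `rowsOfOneLoopFormCode16E`, `CapRowsLatticeJet`,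
`CapRowsQhalf*`, `CapRows.Rows.ofAliasingL1`, …) carries the binder `StripRegularC G κ M` (`Beta.AliasingTailL1`), whose
CERTIFICATE half is a bound `‖G q‖ ≤ M` for EVERY `q` of the closed polystrip `|Re q_μ| ≤ π, |Im q_μ| ≤ κ` — a set of real
dimension `2(d+1)` (= 8 for the cell).  Every pricing of that certificate in the cell (CAP-KERNEL §4.10 (i) «THEOREM MP»,
§4.15 (b) «M = max_face |G| (iterated max modulus; face F_κ = {|Im q_ν| = κ ∀ν})», the option-B anchor budget
`CapLatticeBudget.budget_code16_four`, route A's `B_a := max over the face leaves`) reads `M` off the DISTINGUISHED BOUNDARY of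
the polystrip — the `2^{d+1}` VERTEX TORI `|Im q_μ| = κ ∀μ` (real dimension `d+1`) — by the iterated maximum principle, which
the tree so far applies «by the USER, not here» (`Beta.AliasingTailDeriv`, module docstring; `Beta.AliasingTailSlice` has the
ONE-coordinate case `norm_le_of_periodic_strip`).  This module puts the reduction in the kernel.

* §1 `Tube w` (closed tube `|Im q_μ| ≤ w_μ`, all real parts), `VertexTori w`, and the structure `TubeHol G w`: `G` is
  `2π`-PERIODIC in every coordinate, continuous on the closed tube, and every coordinate slice through a COMPLEX base point
  of the tube is holomorphic on the open strip `|Im z| < w_i` — what every engine stencil family `q ↦ Σ_R K[R] e^{iq·R}`,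
  its determinant, its inverse under (Z1) and its traces ARE (`Beta.TubeHolAlgebra`).  `TubeHol.polyHol`: it implies cap3-g8's `PolyHol`,
  so every binder theorem of `PolyRegularAlgebra` ∕ `PolyRegularRestrict` applies unchanged.
* §2 THE FACE THEOREM `TubeHol.norm_le_of_vertexTori`: `‖G‖ ≤ M` on `VertexTori w` ⟹ `‖G‖ ≤ M` on the whole closed tube
  (induction over the coordinates on `AliasingTailSlice.norm_le_of_periodic_strip` = Phragmén–Lindelöf on a period strip);
  binder forms `TubeHol.polyRegular_of_vertexTori`, `TubeHol.stripRegularC_of_vertexTori`.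
* The ALGEBRA under which `TubeHol` is closed (constants, lattice characters, ring operations, finite sums ∕ products, inverse
  where the denominator has no zero on the period cell; matrix families, `det`, `adjugate`, inverse under (Z1), `trace`, the
  one-loop form and its binder-shaped END over the vertex tori) is the companion module `Beta.TubeHolAlgebra`; the periodic
  reduction `TubeHol.apply_reduceRe` ∕ `TubeHol.ne_zero_of_polyStrip` it needs is §1 here.

HONEST FRAMING.  Kernel glue ([folklore] complex analysis over Mathlib and the tree): no number of the β-function, no binder
INSTANCE for the cell's actual integrand, no certificate; (Z1) (zero-freeness of `det` on the polystrip) is NOT reduced to the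
vertex tori here (that needs winding numbers — CAP-KERNEL §4.8 THEOREM DB — and stays a certificate on the period cell).
Discharging `BetaPertH` would make Bałaban's ultraviolet stability unconditional — NOT the continuum limit, NOT the Clay
problem.  0 `sorry`, 0 cite tags.
-/

namespace Summit.QuantumFields.BalabanUV.Beta.TubeMaximumModulus

open Complex Set
open Literature.MathematicalPhysics.QuantumFieldTheory.Balaban1983to89
open B4Strip (ofRealVec Strip)
open B4ContourShift
open Beta.AliasingTailL1
open Beta.AliasingTailSlice (norm_le_of_periodic_strip)
open Summit.QuantumFields.BalabanUV.Beta.PolyRegularAlgebra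
open scoped Real

noncomputable section

variable {d : ℕ}

/-! ## §1 Tubes, vertex tori, `TubeHol` -/

/-- the closed TUBE `|Im q_μ| ≤ w_μ` (all real parts) with per-coordinate half-widths `w`. [folklore] -/
def Tube {n : ℕ} (w : Fin n → ℝ) : Set (Fin n → ℂ) := {p | ∀ μ, |(p μ).im| ≤ w μ}

/-- the VERTEX TORI of the polystrip period cell (its distinguished boundary): `|Re q_μ| ≤ π` and `|Im q_μ| = w_μ` for EVERY
`μ` — for the cell (`d + 1 = 4`, all `w_μ = κ`) the 16 shifted real tori `Im q = κ·s`, `s ∈ {±1}⁴`. [folklore] -/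
def VertexTori {n : ℕ} (w : Fin n → ℝ) : Set (Fin n → ℂ) := {p | ∀ μ, |(p μ).re| ≤ π ∧ |(p μ).im| = w μ}

/-- the polystrip period cell lies in the tube. [folklore] -/
theorem polyStrip_subset_tube {n : ℕ} (w : Fin n → ℝ) : PolyStrip w ⊆ Tube w := fun _ hp μ => (hp μ).2

/-- the vertex tori lie in the polystrip period cell. [folklore] -/
theorem vertexTori_subset_polyStrip {n : ℕ} (w : Fin n → ℝ) : VertexTori w ⊆ PolyStrip w :=
  fun _ hp μ => ⟨(hp μ).1, (hp μ).2.le⟩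

/-- tubes are monotone in the half-widths. [folklore] -/
theorem tube_mono {n : ℕ} {w w' : Fin n → ℝ} (h : ∀ j, w' j ≤ w j) : Tube w' ⊆ Tube w :=
  fun _ hp μ => (hp μ).trans (h μ)

/-- removing a coordinate of a tube point gives a tube point of the remaining half-widths. [folklore] -/
theorem removeNth_mem_tube {w : Fin (d + 1) → ℝ} (i : Fin (d + 1)) {p : Fin (d + 1) → ℂ} (hp : p ∈ Tube w) :
    i.removeNth p ∈ Tube (fun j => w (i.succAbove j)) := fun j => hp (i.succAbove j)

/-- inserting `z` with `|Im z| ≤ w_i` at coordinate `i` into a tube base point gives a tube point. [folklore] -/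
theorem insertNth_mem_tube {w : Fin (d + 1) → ℝ} (i : Fin (d + 1)) {q : Fin d → ℂ}
    (hq : q ∈ Tube (fun j => w (i.succAbove j))) {z : ℂ} (hz : |z.im| ≤ w i) : i.insertNth z q ∈ Tube w := by
  intro j
  refine Fin.succAboveCases i ?_ ?_ j
  · rw [Fin.insertNth_apply_same]; exact hz
  · intro k; rw [Fin.insertNth_apply_succAbove]; exact hq k

/-- TUBE-HOLOMORPHY of a multiplier `G` with per-coordinate half-widths `w`: `2π`-periodicity in every coordinate (on all of
`ℂ^{d+1}`), continuity on the closed tube, and holomorphy of every coordinate slice through a COMPLEX base point of the tube on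
the open strip `|Im z| < w_i`.  The structural half of the (S4) binder in the form that admits the distinguished-boundary
maximum principle (§2); it implies `PolyHol` (`TubeHol.polyHol`). [folklore] -/
structure TubeHol (G : (Fin (d + 1) → ℂ) → ℂ) (w : Fin (d + 1) → ℝ) : Prop where
  periodic : ∀ (i : Fin (d + 1)) (p : Fin (d + 1) → ℂ), G (Function.update p i (p i + 2 * π)) = G p
  cont : ContinuousOn G (Tube w)
  diff : ∀ (i : Fin (d + 1)) (q : Fin d → ℂ), q ∈ Tube (fun j => w (i.succAbove j)) →
    DifferentiableOn ℂ (fun z => G (i.insertNth z q)) (im ⁻¹' Ioo (-(w i)) (w i))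

variable {G : (Fin (d + 1) → ℂ) → ℂ} {w : Fin (d + 1) → ℝ}

/-- `TubeHol` is monotone in the half-widths. [folklore] -/
theorem TubeHol.of_le {w' : Fin (d + 1) → ℝ} (h : TubeHol G w) (hw : ∀ j, w' j ≤ w j) : TubeHol G w' where
  periodic := h.periodic
  cont := h.cont.mono (tube_mono hw)
  diff i q hq := (h.diff i q (tube_mono (fun j => hw (i.succAbove j)) hq)).mono fun _ hz =>
    ⟨lt_of_le_of_lt (neg_le_neg (hw i)) hz.1, lt_of_lt_of_le hz.2 (hw i)⟩

/-- periodicity along a slice: `z ↦ G (insertNth i z q)` is `2π`-periodic. [folklore] -/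
theorem TubeHol.periodic_slice (h : TubeHol G w) (i : Fin (d + 1)) (q : Fin d → ℂ) :
    Function.Periodic (fun z => G (i.insertNth z q)) (2 * π : ℂ) := by
  intro z
  have e := h.periodic i (i.insertNth z q)
  rw [Fin.insertNth_apply_same, Fin.update_insertNth] at e
  exact e

/-- periodicity by INTEGER multiples of `2π` in one coordinate. [folklore] -/
theorem TubeHol.apply_update_add_int_mul (h : TubeHol G w) (i : Fin (d + 1)) (p : Fin (d + 1) → ℂ) (n : ℤ) :
    G (Function.update p i (p i + n * (2 * π))) = G p := by
  induction n using Int.induction_on with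
  | zero => simp
  | succ n ih =>
    have e := h.periodic i (Function.update p i (p i + ((n : ℤ) : ℂ) * (2 * π)))
    rw [Function.update_self, Function.update_idem] at e
    rw [← ih, ← e]
    congr 2; push_cast; ring
  | pred n ih =>
    have e := h.periodic i (Function.update p i (p i + ((-(n : ℤ) - 1 : ℤ) : ℂ) * (2 * π)))
    rw [Function.update_self, Function.update_idem] at e
    rw [← e, ← ih]
    congr 2; push_cast; ring

/-- periodicity by an integer vector of multiples of `2π` in all coordinates at once. [folklore] -/
theorem TubeHol.apply_add_int_mul (h : TubeHol G w) (p : Fin (d + 1) → ℂ) (n : Fin (d + 1) → ℤ) :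
    G (fun μ => p μ + n μ * (2 * π)) = G p := by
  classical
  suffices H : ∀ s : Finset (Fin (d + 1)),
      G (fun μ => p μ + if μ ∈ s then (n μ : ℂ) * (2 * π) else 0) = G p by
    have e : (fun μ => p μ + n μ * (2 * π)) = fun μ => p μ + if μ ∈ Finset.univ then (n μ : ℂ) * (2 * π) else 0 := by
      funext μ; rw [if_pos (Finset.mem_univ μ)]
    rw [e]; exact H _
  intro s
  refine Finset.induction_on s (by simp) ?_
  intro a s ha ih
  have e : (fun μ => p μ + if μ ∈ insert a s then (n μ : ℂ) * (2 * π) else 0) =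
      Function.update (fun μ => p μ + if μ ∈ s then (n μ : ℂ) * (2 * π) else 0) a
        ((fun μ => p μ + if μ ∈ s then (n μ : ℂ) * (2 * π) else 0) a + n a * (2 * π)) := by
    funext μ
    simp only [Function.update_apply, Finset.mem_insert]
    by_cases hμ : μ = a
    · subst hμ; simp [ha]
    · simp [hμ]
  rw [e, h.apply_update_add_int_mul, ih]

/-- REDUCTION OF THE REAL PARTS INTO THE PERIOD CELL: subtract from each coordinate the integer multiple of `2π` that puts its
real part into `[-π, π)`. [folklore] -/
def reduceRe {n : ℕ} (p : Fin n → ℂ) : Fin n → ℂ :=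
  fun μ => p μ + (-(toIcoDiv Real.two_pi_pos (-π) (p μ).re) : ℤ) * (2 * π)

/-- the reduction in real-cast form. [folklore] -/
theorem reduceRe_apply {n : ℕ} (p : Fin n → ℂ) (μ : Fin n) :
    reduceRe p μ = p μ + (((-(toIcoDiv Real.two_pi_pos (-π) (p μ).re) : ℤ) : ℝ) * (2 * π) : ℝ) := by
  simp only [reduceRe]; push_cast; ring

/-- the reduced real part. [folklore] -/
theorem reduceRe_re {n : ℕ} (p : Fin n → ℂ) (μ : Fin n) :
    (reduceRe p μ).re = (p μ).re - (toIcoDiv Real.two_pi_pos (-π) (p μ).re : ℝ) * (2 * π) := by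
  rw [reduceRe_apply, add_re, ofReal_re]; push_cast; ring

/-- the reduced point has real parts in `[-π, π)`. [folklore] -/
theorem reduceRe_re_mem {n : ℕ} (p : Fin n → ℂ) (μ : Fin n) : (reduceRe p μ).re ∈ Ico (-π) π := by
  have h := sub_toIcoDiv_zsmul_mem_Ico Real.two_pi_pos (-π) (p μ).re
  rw [zsmul_eq_mul, show -π + 2 * π = π by ring] at h
  rw [reduceRe_re]; exact h

/-- the reduced point has `|Re| ≤ π` in every coordinate. [folklore] -/
theorem abs_reduceRe_re_le {n : ℕ} (p : Fin n → ℂ) (μ : Fin n) : |(reduceRe p μ).re| ≤ π :=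
  abs_le.mpr ⟨(reduceRe_re_mem p μ).1, (reduceRe_re_mem p μ).2.le⟩

/-- the reduction does not change imaginary parts. [folklore] -/
theorem reduceRe_im {n : ℕ} (p : Fin n → ℂ) (μ : Fin n) : (reduceRe p μ).im = (p μ).im := by
  rw [reduceRe_apply, add_im, ofReal_im, add_zero]

/-- a tube point reduces into the polystrip period cell. [folklore] -/
theorem reduceRe_mem_polyStrip {n : ℕ} {w : Fin n → ℝ} {p : Fin n → ℂ} (hp : p ∈ Tube w) : reduceRe p ∈ PolyStrip w :=
  fun μ => ⟨abs_reduceRe_re_le p μ, by rw [reduceRe_im]; exact hp μ⟩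

/-- a point with all `|Im q_μ| = w_μ` reduces onto the vertex tori. [folklore] -/
theorem reduceRe_mem_vertexTori {n : ℕ} {w : Fin n → ℝ} {p : Fin n → ℂ} (hp : ∀ μ, |(p μ).im| = w μ) :
    reduceRe p ∈ VertexTori w :=
  fun μ => ⟨abs_reduceRe_re_le p μ, by rw [reduceRe_im]; exact hp μ⟩

/-- PERIODIC REDUCTION: a tube-holomorphic multiplier takes the same value at a point and at its reduction. [folklore] -/
theorem TubeHol.apply_reduceRe (h : TubeHol G w) (p : Fin (d + 1) → ℂ) : G (reduceRe p) = G p :=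
  h.apply_add_int_mul p _

/-- non-vanishing on the period cell extends to the tube. [folklore] -/
theorem TubeHol.ne_zero_of_polyStrip (h : TubeHol G w) (hne : ∀ p ∈ PolyStrip w, G p ≠ 0) :
    ∀ p ∈ Tube w, G p ≠ 0 := by
  intro p hp
  rw [← h.apply_reduceRe p]
  exact hne _ (reduceRe_mem_polyStrip hp)

/-- a bound on the period cell extends to the tube. [folklore] -/
theorem TubeHol.norm_le_of_polyStrip (h : TubeHol G w) {M : ℝ} (hM : ∀ p ∈ PolyStrip w, ‖G p‖ ≤ M) :
    ∀ p ∈ Tube w, ‖G p‖ ≤ M := by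
  intro p hp
  rw [← h.apply_reduceRe p]
  exact hM _ (reduceRe_mem_polyStrip hp)

/-- `TubeHol` IMPLIES cap3-g8's `PolyHol` (continuity by restriction, slice holomorphy by restriction to the open rectangle,
matching vertical sides by periodicity) — so every binder theorem over `PolyHol` applies to a `TubeHol` multiplier. [folklore] -/
theorem TubeHol.polyHol (h : TubeHol G w) : PolyHol G w where
  cont := h.cont.mono (polyStrip_subset_tube w)
  diff i q hq := (h.diff i q (polyStrip_subset_tube _ hq)).mono fun z hz => (mem_reProdIm.1 hz).2
  sides i q _ y _ := by
    have e : (-π + y * I : ℂ) + 2 * π = π + y * I := by ring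
    have hp := h.periodic i (i.insertNth (-π + y * I) q)
    rw [Fin.insertNth_apply_same, Fin.update_insertNth, e] at hp
    exact hp.symm

/-- the slice of a tube-holomorphic multiplier through a tube base point is `DiffContOnCl` on the open strip. [folklore] -/
theorem TubeHol.diffContOnCl_slice (h : TubeHol G w) (i : Fin (d + 1)) {q : Fin d → ℂ}
    (hq : q ∈ Tube (fun j => w (i.succAbove j))) :
    DiffContOnCl ℂ (fun z => G (i.insertNth z q)) (im ⁻¹' Ioo (-(w i)) (w i)) := by
  refine ⟨h.diff i q hq, ?_⟩
  rw [closure_preimage_im]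
  have hsub : im ⁻¹' closure (Ioo (-(w i)) (w i)) ⊆ im ⁻¹' Icc (-(w i)) (w i) :=
    preimage_mono (closure_minimal Ioo_subset_Icc_self isClosed_Icc)
  refine ContinuousOn.mono ?_ hsub
  have hmaps : MapsTo (fun z : ℂ => (i.insertNth z q : Fin (d + 1) → ℂ)) (im ⁻¹' Icc (-(w i)) (w i)) (Tube w) :=
    fun z hz => insertNth_mem_tube i hq (abs_le.mpr ⟨hz.1, hz.2⟩)
  have hc : Continuous (fun z : ℂ => (i.insertNth z q : Fin (d + 1) → ℂ)) :=
    Continuous.finInsertNth i continuous_id continuous_const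
  exact h.cont.comp hc.continuousOn hmaps

/-! ## §2 The distinguished-boundary maximum principle -/

/-- ONE STEP of the iterated maximum principle: if `‖G‖ ≤ M` at every tube point whose coordinates OUTSIDE `s` all lie on
their boundary circles `|Im q_j| = w_j`, then the same holds with `s` enlarged by one coordinate `i` — the coordinate `i`
is released by the maximum principle on its period strip (`norm_le_of_periodic_strip`), the others frozen at COMPLEX
values. [folklore] -/
theorem TubeHol.norm_le_step (h : TubeHol G w) {M : ℝ} (s : Finset (Fin (d + 1))) (i : Fin (d + 1))
    (hs : ∀ p ∈ Tube w, (∀ j, j ∉ s → |(p j).im| = w j) → ‖G p‖ ≤ M) :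
    ∀ p ∈ Tube w, (∀ j, j ∉ insert i s → |(p j).im| = w j) → ‖G p‖ ≤ M := by
  intro p hp hb
  by_cases hpi : |(p i).im| = w i
  · refine hs p hp fun j hj => ?_
    by_cases hji : j = i
    · rw [hji]; exact hpi
    · exact hb j (by rw [Finset.mem_insert, not_or]; exact ⟨hji, hj⟩)
  · have hlt : |(p i).im| < w i := lt_of_le_of_ne (hp i) hpi
    have hκ : 0 < w i := lt_of_le_of_lt (abs_nonneg _) hlt
    set q : Fin d → ℂ := i.removeNth p with hq_def
    have hq : q ∈ Tube (fun j => w (i.succAbove j)) := removeNth_mem_tube i hp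
    have hC : ∀ z : ℂ, |z.im| = w i → ‖G (i.insertNth z q)‖ ≤ M := by
      intro z hz
      refine hs _ (insertNth_mem_tube i hq hz.le) fun j hj => ?_
      refine Fin.succAboveCases i ?_ ?_ j hj
      · intro _; rw [Fin.insertNth_apply_same]; exact hz
      · intro k hk
        rw [Fin.insertNth_apply_succAbove, hq_def, Fin.removeNth_apply]
        refine hb _ fun hmem => hk ?_
        rcases Finset.mem_insert.mp hmem with h1 | h1
        · exact absurd h1 (Fin.succAbove_ne i k)
        · exact h1
    have key := norm_le_of_periodic_strip hκ (h.periodic_slice i q) (h.diffContOnCl_slice i hq) hC hlt.le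
    rwa [hq_def, Fin.insertNth_self_removeNth] at key

/-- THE DISTINGUISHED-BOUNDARY MAXIMUM PRINCIPLE (all real parts): a tube-holomorphic multiplier bounded by `M` at the tube
points with `|Im q_μ| = w_μ` for EVERY `μ` is bounded by `M` on the whole closed tube. [folklore] -/
theorem TubeHol.norm_le_of_face (h : TubeHol G w) {M : ℝ}
    (hM : ∀ p ∈ Tube w, (∀ μ, |(p μ).im| = w μ) → ‖G p‖ ≤ M) : ∀ p ∈ Tube w, ‖G p‖ ≤ M := by
  classical
  suffices H : ∀ s : Finset (Fin (d + 1)), ∀ p ∈ Tube w, (∀ j, j ∉ s → |(p j).im| = w j) → ‖G p‖ ≤ M from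
    fun p hp => H Finset.univ p hp fun j hj => absurd (Finset.mem_univ j) hj
  intro s
  refine Finset.induction_on s (fun p hp hb => hM p hp fun μ => hb μ (Finset.notMem_empty μ)) ?_
  intro i s _ ih
  exact h.norm_le_step s i ih

/-- **THE FACE THEOREM (period cell)**: a tube-holomorphic multiplier bounded by `M` on the VERTEX TORI `|Re q_μ| ≤ π`,
`|Im q_μ| = w_μ ∀μ` is bounded by `M` on the whole closed tube — `sup_{tube} |G| = max_{vertex tori} |G|`.  For the cell:
the (Z2) certificate is a bound on 16 real 4-tori, not on the 8-dimensional polystrip. [folklore] -/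
theorem TubeHol.norm_le_of_vertexTori (h : TubeHol G w) {M : ℝ} (hM : ∀ p ∈ VertexTori w, ‖G p‖ ≤ M) :
    ∀ p ∈ Tube w, ‖G p‖ ≤ M :=
  h.norm_le_of_face fun p _ hb => by rw [← h.apply_reduceRe p]; exact hM _ (reduceRe_mem_vertexTori hb)

/-- the same, read on the polystrip period cell. [folklore] -/
theorem TubeHol.norm_le_polyStrip_of_vertexTori (h : TubeHol G w) {M : ℝ} (hM : ∀ p ∈ VertexTori w, ‖G p‖ ≤ M) :
    ∀ p ∈ PolyStrip w, ‖G p‖ ≤ M :=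
  fun p hp => h.norm_le_of_vertexTori hM p (polyStrip_subset_tube w hp)

/-- conversely (trivially) a polystrip bound is a vertex-tori bound: the admissible constants coincide. [folklore] -/
theorem norm_le_vertexTori_of_polyStrip {M : ℝ} (hM : ∀ p ∈ PolyStrip w, ‖G p‖ ≤ M) :
    ∀ p ∈ VertexTori w, ‖G p‖ ≤ M :=
  fun p hp => hM p (vertexTori_subset_polyStrip w hp)

/-- BINDER FORM: STRUCTURE (`TubeHol`) + a certified bound on the vertex tori ⟹ `PolyRegular G w M`. [folklore] -/
theorem TubeHol.polyRegular_of_vertexTori (h : TubeHol G w) {M : ℝ} (hM : ∀ p ∈ VertexTori w, ‖G p‖ ≤ M) :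
    PolyRegular G w M :=
  h.polyHol.regular (h.norm_le_polyStrip_of_vertexTori hM)

/-- BINDER FORM, equal half-widths: `TubeHol G κ` + a certified bound `M` on the `2^{d+1}` vertex tori `Im q = κ·s`,
`s ∈ {±1}^{d+1}` ⟹ the cell's binder `StripRegularC G κ M`. [folklore] -/
theorem TubeHol.stripRegularC_of_vertexTori {κ M : ℝ} (h : TubeHol G (fun _ => κ))
    (hM : ∀ p ∈ VertexTori (fun _ : Fin (d + 1) => κ), ‖G p‖ ≤ M) : StripRegularC G κ M :=
  h.polyRegular_of_vertexTori hM


end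

end Summit.QuantumFields.BalabanUV.Beta.TubeMaximumModulus
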